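import Mathlib.Tactic.Linarith
import Literature.Combinatorics.Additive.NeumannTPPInequality
import HarnessLib

/-!
# `|S| + |T| + |U| ≤ |G| + 2` for TPP triples (Hedtke–Murthy 2012, Lemma 2.2 and Observation 2.3)

Topic `Literature/Combinatorics/Additive` (triple product property; companion of `NeumannTPPInequality.lean`, whose
Neumann inequality `|S|·(|T|+|U|−1) ≤ |G|` (P. M. Neumann 2011, Obs. 3.1 = Hedtke–Murthy Lemma 2.11) is the input).

I. Hedtke, S. Murthy, *Search and test algorithms for triple product property triples*, Groups Complex. Cryptol.
4 (2012), doi:10.1515/gcc-2012-0006 = arXiv:1104.5097, §2 (held text `paper:arxiv-1104.5097` chunk p0005 L14–21),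
verbatim:

> **Lemma 2.2.** If `(S,T,U)` is a TPP triple of `G`, then `|S| + |T| + |U| ≤ |G| + 2`.
> First we note, that we are only interested in matrix-matrix multiplication, that means, we consider only TPP
> triples `(S,T,U)` with `|S|, |T|, |U| > 1`. Furthermore we have: Assume that in a TPP triple of `G` one of `S`, `T`
> or `U` is `G` itself. Then it follows from the lemma above, that the other two sets of the triple have size `1`.
> Because we omit this case, we only use:
> **Observation 2.3.** It is sufficient to search TPP triples with `|S|, |T|, |U| ∈ {2, …, |G| − 1}`.

(The paper's TPP, Def. 1.2, is for NON-EMPTY subsets; the tree's `TripleProductProperty` is vacuous on an empty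
member, so non-emptiness is an explicit hypothesis below.)

## Results (all proved; `0 defs / 0 facts`)
* `HedtkeMurthy2012_lemma22` — `|S| + |T| + |U| ≤ |G| + 2` (from Neumann's inequality: with `a = |S| ≥ 1`,
  `b = |T| + |U| − 1 ≥ 1`, `ab ≤ |G|` gives `a + b ≤ ab + 1 ≤ |G| + 1`).
* `HedtkeMurthy2012_lemma22_eq_card` — if `|S| = |G|` then `|T| = |U| = 1` ("the other two sets have size 1").
* `HedtkeMurthy2012_obs23` — if `|T| ≥ 2` or `|U| ≥ 2` then `|S| ≤ |G| − 1` (the search bound of Obs. 2.3 for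
  the first member; the other members by `TripleProductProperty.rotate`).

## References
* I. Hedtke, S. Murthy, arXiv:1104.5097 = Groups Complex. Cryptol. 4 (2012): Lemma 2.2, Observation 2.3 (§2).
  [HedtkeMurthy2012]
* P. M. Neumann, *A note on the triple product property for subsets of finite groups*, LMS J. Comput. Math. 14
  (2011): Obs. 3.1 (tree `TripleProductProperty.card_mul_le_neumann`). [Neumann2011]
-/

namespace Literature.Combinatorics.Additive

open Finset

variable {G : Type*} [Group G] [DecidableEq G]

/-- **Hedtke–Murthy 2012, Lemma 2.2**: for a TPP triple of non-empty subsets of a finite group,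
`|S| + |T| + |U| ≤ |G| + 2`. [cite: HedtkeMurthy2012, Lemma 2.2] -/
theorem HedtkeMurthy2012_lemma22 [Fintype G] {S T U : Finset G} (h : TripleProductProperty S T U)
    (hS : S.Nonempty) (hT : T.Nonempty) (hU : U.Nonempty) :
    S.card + T.card + U.card ≤ Fintype.card G + 2 := by
  have hN := h.card_mul_le_neumann hS hT hU
  have ha : 1 ≤ S.card := card_pos.2 hS
  have hb : 1 ≤ T.card := card_pos.2 hT
  have hc : 1 ≤ U.card := card_pos.2 hU
  -- `a + b ≤ a b + 1` for `a, b ≥ 1`, with `a = |S|`, `b = |T| + |U| - 1`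
  obtain ⟨b, hbdef⟩ : ∃ b, T.card + U.card - 1 = b + 1 := ⟨T.card + U.card - 2, by omega⟩
  obtain ⟨a, hadef⟩ : ∃ a, S.card = a + 1 := ⟨S.card - 1, by omega⟩
  rw [hadef, hbdef] at hN
  have key : (a + 1) + (b + 1) ≤ (a + 1) * (b + 1) + 1 := by nlinarith [Nat.zero_le (a * b)]
  omega

/-- **Hedtke–Murthy 2012, after Lemma 2.2**: "Assume that in a TPP triple of `G` one of `S, T` or `U` is `G` itself.
Then … the other two sets of the triple have size `1`" — stated for the first member (`|S| = |G|`); the other cases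
by `TripleProductProperty.rotate`. [cite: HedtkeMurthy2012, Lemma 2.2 (remark after it)] -/
theorem HedtkeMurthy2012_lemma22_eq_card [Fintype G] {S T U : Finset G} (h : TripleProductProperty S T U)
    (hSG : S.card = Fintype.card G) (hT : T.Nonempty) (hU : U.Nonempty) : T.card = 1 ∧ U.card = 1 := by
  have hS : S.Nonempty := by rw [← card_pos, hSG]; exact Fintype.card_pos
  have hN := h.card_mul_le_neumann hS hT hU
  have hb : 1 ≤ T.card := card_pos.2 hT
  have hc : 1 ≤ U.card := card_pos.2 hU
  rw [hSG] at hN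
  have hG : 0 < Fintype.card G := Fintype.card_pos
  have : T.card + U.card - 1 ≤ 1 := by
    by_contra hlt
    have h2 : 2 ≤ T.card + U.card - 1 := by omega
    have := Nat.mul_le_mul_left (Fintype.card G) h2
    omega
  omega

/-- **Hedtke–Murthy 2012, Observation 2.3** ("It is sufficient to search TPP triples with
`|S|, |T|, |U| ∈ {2, …, |G| − 1}`"): if another member has at least two elements then `|S| ≤ |G| − 1`.
[cite: HedtkeMurthy2012, Observation 2.3] -/
theorem HedtkeMurthy2012_obs23 [Fintype G] {S T U : Finset G} (h : TripleProductProperty S T U)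
    (hT : T.Nonempty) (hU : U.Nonempty) (h2 : 2 ≤ T.card ∨ 2 ≤ U.card) : S.card ≤ Fintype.card G - 1 := by
  have hle : S.card ≤ Fintype.card G := card_le_univ S
  rcases Nat.lt_or_ge S.card (Fintype.card G) with hlt | hge
  · omega
  · obtain ⟨hT1, hU1⟩ := HedtkeMurthy2012_lemma22_eq_card h (le_antisymm hle hge) hT hU
    omega

end Literature.Combinatorics.Additive
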